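import Summits.RiemannHypothesis.RiemannHypothesis.Theorems.LiDirichletTrend
import Summits.RiemannHypothesis.RiemannHypothesis.Theorems.LiDirichletAsymptoticDefs
import Mathlib.NumberTheory.Harmonic.EulerMascheroni
import HarnessLib

/-!
# PART F″ (cell rh-li, engine seat rh-li-eng-5 gen 4) — the Dirichlet Li TREND against route No.12's MAIN TERM
# (RH-FREE, GRH-FREE harmonic-number bookkeeping)

Route No.12 `LiDirichletAsymptotic` (PART H, `LiDirichletAsymptoticDefs.lean`) states its leaf with the χ-main term
`charLiMainTerm q n = liMainTerm n + (n/2) log q = (n/2) log n + C₁ n + (n/2) log q`, `C₁ = liC1 = (γ − 1 − log 2π)/2`, and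
announces (docstring, "support `CharLiMainTerm_sub_trend`, harmonic-number bookkeeping") that this main term is PART F's
archimedean trend `charLiTrendMain χ n = (n/2)(H_n − 1 − log(2π/q)) + (a − 1)/2` up to `≤ 1`.  This file proves it, with the
sharp constant `1/2`, and combines it with T-D2 (`liDirichletTrend_holds`, here in its constant-`1` Literature form
`Literature.NumberTheory.LFunctions.abs_re_liTrendGen_sub_le`):

* `abs_charLiTrendMain_sub_charLiMainTerm_le` — `|charLiTrendMain χ n − charLiMainTerm q n| ≤ 1/2` (`n ≥ 1`):
  the difference is `(n/2)(H_n − log n − γ) + (a−1)/2` and `0 < H_n − log n − γ ≤ 1/n` (Mathlib's Euler–Mascheroni sequences);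
* `abs_charLiTrend_sub_charLiTrendMain_le_one` — T-D2 with the constant `1` (the typed `LiDirichletTrend` has `2`);
* `abs_charLiTrend_sub_charLiMainTerm_le` — **`|charLiTrend χ n − charLiMainTerm q n| ≤ 3/2`** for every `q ≥ 1`, `χ mod q`,
  `n ≥ 1`: the archimedean trend `lb_χ(n)` of the certified tables (HOME/data/li_dirichlet_lambda_*.tsv, column `lb`) IS route
  No.12's main term up to `3/2`, uniformly in `q`, `χ`, `n`.  Consequently, once T-D2s `LiDirichletSplit`
  (`liCoeffCharRe = charLiTrend + charLiOsc`) is proved, the leaf `LiDirichletAsymptoticLaw` reads on the Taylor side as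
  `|lt_χ(n)| = |charLiOsc χ n| ≤ C √n log(qn) + 3/2` on the verified range (data: `sup |lt|/(√n log qn) = 0.091`, DATA.md §J v3).

**Nothing in this file bears on the truth of RH or GRH**: elementary inequalities between explicit elementary functions of
`n`, `q`, `a` plus the Gamma-factor law T-D2; no zero and no value of `L(s, χ)` enters.  bears_on: LADDER-RH L-D (COLUMN 4 LI,
Dirichlet rows) ↔ L-P(P1⁺χ) vocabulary.
-/

noncomputable section

-- D-0017: `Summit.<S>.<S>.…` is the designed namespace of a single-problem summit.
set_option linter.dupNamespace false

namespace Summit.RiemannHypothesis.RiemannHypothesis.Theorems.LiTheory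

open Literature.NumberTheory.LFunctions

variable {q : ℕ} [NeZero q]

/-- Mathlib's Euler–Mascheroni sequences give `log n + γ ≤ H_n ≤ log n + γ + 1/n` for `n ≥ 1`. [folklore] -/
private theorem log_add_eulerMascheroni_le_harmonic' {n : ℕ} (hn : 1 ≤ n) :
    Real.log n + Real.eulerMascheroniConstant ≤ (harmonic n : ℝ) ∧
      (harmonic n : ℝ) ≤ Real.log n + Real.eulerMascheroniConstant + 1 / n := by
  have hn0 : (0 : ℝ) < n := by exact_mod_cast hn
  constructor
  · have h := Real.eulerMascheroniConstant_lt_eulerMascheroniSeq' n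
    rw [Real.eulerMascheroniSeq', if_neg (by omega)] at h
    linarith
  · have h1 := Real.eulerMascheroniSeq_lt_eulerMascheroniConstant n
    rw [Real.eulerMascheroniSeq] at h1
    have h2 : Real.log (n + 1) ≤ Real.log n + 1 / n := by
      have h3 := Real.log_le_sub_one_of_pos (x := ((n : ℝ) + 1) / n) (by positivity)
      rw [Real.log_div (by positivity) hn0.ne'] at h3
      have h4 : ((n : ℝ) + 1) / n - 1 = 1 / n := by field_simp; ring
      linarith
    linarith

omit [NeZero q] in
/-- The parity `a = charParity χ` is `0` or `1`. [folklore] -/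
private theorem charParity_le_one' (χ : DirichletCharacter ℂ q) : charParity χ ≤ 1 := by
  unfold charParity; split_ifs <;> norm_num

/-- **RH-FREE bookkeeping: PART F's trend main term vs PART H's χ-main term.**  For every `q ≥ 1`, `χ mod q`, `n ≥ 1`:

  `| charLiTrendMain χ n − charLiMainTerm q n | ≤ 1/2`,

since `charLiTrendMain χ n − charLiMainTerm q n = (n/2)(H_n − log n − γ) + (a − 1)/2` with `0 ≤ (n/2)(H_n − log n − γ) ≤ 1/2`
and `(a−1)/2 ∈ {−1/2, 0}`.  (This is the support «`CharLiMainTerm_sub_trend`» announced in PART H's docstring, with `1/2`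
in place of `1`.) [folklore] -/
theorem abs_charLiTrendMain_sub_charLiMainTerm_le (χ : DirichletCharacter ℂ q) {n : ℕ} (hn : 1 ≤ n) :
    |charLiTrendMain χ n - charLiMainTerm q n| ≤ 1 / 2 := by
  have hn0 : (0 : ℝ) < n := by exact_mod_cast hn
  have hq0 : (q : ℝ) ≠ 0 := by exact_mod_cast NeZero.ne q
  obtain ⟨hlo, hhi⟩ := log_add_eulerMascheroni_le_harmonic' hn
  have ha : (charParity χ : ℝ) ≤ 1 := by exact_mod_cast charParity_le_one' χ
  have ha0 : (0 : ℝ) ≤ charParity χ := Nat.cast_nonneg _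
  have hlog : Real.log (2 * Real.pi / q) = Real.log (2 * Real.pi) - Real.log q :=
    Real.log_div (by positivity) hq0
  have hdiff : charLiTrendMain χ n - charLiMainTerm q n =
      (n : ℝ) / 2 * ((harmonic n : ℝ) - Real.log n - Real.eulerMascheroniConstant) + ((charParity χ : ℝ) - 1) / 2 := by
    simp only [charLiTrendMain, charLiMainTerm, liMainTerm, liC1, hlog]
    ring
  rw [hdiff, abs_le]
  have h1 : 0 ≤ (n : ℝ) / 2 * ((harmonic n : ℝ) - Real.log n - Real.eulerMascheroniConstant) :=
    mul_nonneg (by positivity) (by linarith)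
  have h2 : (n : ℝ) / 2 * ((harmonic n : ℝ) - Real.log n - Real.eulerMascheroniConstant) ≤ 1 / 2 := by
    have h3 : (harmonic n : ℝ) - Real.log n - Real.eulerMascheroniConstant ≤ 1 / n := by linarith
    calc (n : ℝ) / 2 * ((harmonic n : ℝ) - Real.log n - Real.eulerMascheroniConstant)
        ≤ (n : ℝ) / 2 * (1 / n) := by gcongr
      _ = 1 / 2 := by field_simp
  constructor <;> linarith

/-- **T-D2 with the constant `1`** (the typed `LiDirichletTrend` carries `2`): for every `q ≥ 1`, `χ mod q`, `n ≥ 1`,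
`|charLiTrend χ n − charLiTrendMain χ n| ≤ 1` — `Literature.NumberTheory.LFunctions.abs_re_liTrendGen_sub_le` at
`c = log(q/π)`, `a = charParity χ`. [cite: Lagarias2007LiCoefficients, (1.13)–(1.15); Voros2006, §4] -/
theorem abs_charLiTrend_sub_charLiTrendMain_le_one (χ : DirichletCharacter ℂ q) {n : ℕ} (hn : 1 ≤ n) :
    |charLiTrend χ n - charLiTrendMain χ n| ≤ 1 := by
  obtain ⟨m, rfl⟩ : ∃ m, n = m + 1 := ⟨n - 1, by omega⟩
  have hq0 : (q : ℝ) ≠ 0 := by exact_mod_cast NeZero.ne q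
  have key := abs_re_liTrendGen_sub_le (Real.log ((q : ℝ) / Real.pi)) (charParity_le_one' χ) m
  have hlog : Real.log (2 * Real.pi / q) = Real.log 2 - Real.log ((q : ℝ) / Real.pi) := by
    rw [Real.log_div (by positivity) hq0, Real.log_mul two_ne_zero Real.pi_ne_zero,
      Real.log_div hq0 Real.pi_ne_zero]
    ring
  have e1 : charLiTrend χ (m + 1) =
      (iteratedDeriv m (fun z ↦ ((Real.log ((q : ℝ) / Real.pi) : ℂ) / 2 +
        Complex.digamma ((liMap z + (charParity χ : ℂ)) / 2) / 2) * liMap z ^ 2) 0 / (m.factorial : ℂ)).re := by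
    simp only [charLiTrend, Nat.add_sub_cancel]
    rfl
  have e2 : charLiTrendMain χ (m + 1) =
      ((m + 1 : ℕ) : ℝ) / 2 * ((harmonic (m + 1) : ℝ) - 1 - Real.log 2 + Real.log ((q : ℝ) / Real.pi)) +
        ((charParity χ : ℝ) - 1) / 2 := by
    simp only [charLiTrendMain, hlog]
    ring
  rw [e1, e2]
  exact key

/-- **RH-FREE. The archimedean trend IS route No.12's main term, up to `3/2`, uniformly.**  For every `q ≥ 1`, every
character `χ mod q` and every `n ≥ 1`:

  `| lb_χ(n) − ( (n/2) log n + C₁ n + (n/2) log q ) | ≤ 3/2`,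

`lb_χ(n) = charLiTrend χ n` (the Li functional of the Gamma factor of `ξ(s,χ)`; the certified tables' column `lb`),
`C₁ = (γ − 1 − log 2π)/2`.  Triangle inequality from `abs_charLiTrend_sub_charLiTrendMain_le_one` (T-D2, constant `1`) and
`abs_charLiTrendMain_sub_charLiMainTerm_le` (`1/2`).  With T-D2s (`LiDirichletSplit`, open) the leaf `LiDirichletAsymptoticLaw`
then bounds the arithmetic part: `|charLiOsc χ n| ≤ C√n log(qn) + 3/2` on the verified range.
[cite: Lagarias2007LiCoefficients, (1.13)–(1.15)] -/
theorem abs_charLiTrend_sub_charLiMainTerm_le (χ : DirichletCharacter ℂ q) {n : ℕ} (hn : 1 ≤ n) :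
    |charLiTrend χ n - charLiMainTerm q n| ≤ 3 / 2 := by
  have h1 := abs_charLiTrend_sub_charLiTrendMain_le_one χ hn
  have h2 := abs_charLiTrendMain_sub_charLiMainTerm_le χ hn
  have hsplit : charLiTrend χ n - charLiMainTerm q n =
      (charLiTrend χ n - charLiTrendMain χ n) + (charLiTrendMain χ n - charLiMainTerm q n) := by ring
  rw [hsplit]
  calc |(charLiTrend χ n - charLiTrendMain χ n) + (charLiTrendMain χ n - charLiMainTerm q n)|
      ≤ |charLiTrend χ n - charLiTrendMain χ n| + |charLiTrendMain χ n - charLiMainTerm q n| := abs_add_le _ _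
    _ ≤ 1 + 1 / 2 := add_le_add h1 h2
    _ = 3 / 2 := by norm_num

end Summit.RiemannHypothesis.RiemannHypothesis.Theorems.LiTheory

end
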